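import Mathlib
import HarnessLib
import Literature.Analysis.FluidPDE.SelfSimilar
import Summits.NavierStokesRegularity.NavierStokesRegularity.Theorems.HalfSpaceWindowDoorCirculationCarryingRigidityWindowedFlux

/-!
# Route `HalfSpaceWindowDoor`, crux `CirculationCarryingRigidity` (stmt-NavierStokesRegularity-25311) — FINITE PLANE
# CIRCULATION of closed-hemisphere profiles with SPACE–TIME Type-I decay (the sign-using half of the planner's v1 mechanism)

Critic P1 of the line `birth` observed that in the route's time-only Type-I class the plane flux
`Φ(c,t) = ∫_{x₂=c} ⟪curl v, e₃⟫` can be infinite (disc circulations grow like `L/√(−t)`, see `…WindowedFlux`).  In the natural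
subclass of blow-up profiles with SPACE–TIME Type-I decay `‖v(t,x)‖ ≤ D/(‖x‖ + √(−t))` (`HasTypeIDecay`, KNSS 2009 (1.6); the
profiles produced from a GLOBALLY Type-I singularity) the closed-hemisphere SIGN makes the plane flux FINITE and uniformly
bounded: `Φ(c,t) ≤ 4πD` for every height `c` and time `t < 0`.

Mechanism (Kelvin–Stokes against a centred Gaussian window, then monotone convergence):
* `integral_inner_curl_e3_mul_gaussWin_eq` — the windowed Stokes identity `∫ ω₃(y,c) g(y) dy = −∫ v₁ ∂₀g + ∫ v₀ ∂₁g` on the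
  plane, for a bounded `C¹` field with bounded gradient (the identity inside `…WindowedFlux.windowedCirculation_le`, exposed);
* `abs_integral_inner_curl_e3_mul_gaussWin_le_of_decay` — if moreover `‖V(x)‖ (‖x‖ + ρ) ≤ D` (`ρ > 0`), then for the window
  centred at the origin `|∫ ω₃(y,c) g_{L,0}(y) dy| ≤ D/L²` (since `|∂ⱼg_{L,0}(y)| ≤ g‖y‖/(2L²)` and `‖V(y,c)‖ ‖y‖ ≤ D`);
* `planeFlux_le_of_decay` — with the sign `ω₃ ≥ 0`: `∫⁻_{ℝ²} ω₃(y,c) dy ≤ 4πD` (test against `e^{−‖y‖²/(4L²)} = 4πL² g_{L,0} ↑ 1`);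
* `planeFlux_le_of_class_of_hasTypeIDecay` — the class form: a closed-hemisphere profile of the route's Type-I class with
  space–time decay constant `D` has `∫⁻_{ℝ²} ⟪curl v(s)(y,c), e₃⟫ dy ≤ 4πD` for all `s < 0`, `c`.

So in this subclass the v1 picture (conserved finite plane circulation) is available; the research step (positivity ⇒
spreading against critical tilting) is unchanged.  Seat ns-hsw-p1 (LEAD of 25311, cell pub-ns-dss).  WHAT THIS IS NOT: not a
statement about Navier–Stokes regularity; a-priori structure of HYPOTHETICAL blow-up profiles; `--supports` the crux.
-/

noncomputable section

-- the summit and its single sub-problem share the name (CONVENTIONS §1), as in every Theorems file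
set_option linter.dupNamespace false

namespace Summit.NavierStokesRegularity.NavierStokesRegularity.Theorems.HalfSpaceWindowDoorCirculationCarryingRigidityPlaneFlux

open MeasureTheory Set Function Filter Topology
open scoped RealInnerProductSpace InnerProductSpace ENNReal
open Literature.Analysis Literature.Analysis.FluidPDE Literature.Analysis.UnboundedOperators
open Summit.NavierStokesRegularity.NavierStokesRegularity.Theorems.HalfSpaceWindowDoorCirculationCarryingRigidityDefs
open Summit.NavierStokesRegularity.NavierStokesRegularity.Theorems.HalfSpaceWindowDoorCirculationCarryingRigidityWindowedFlux
  (gaussWin_eq_heatKernel gaussWin_eq_heatKernel' gaussWin_pos hasFDerivAt_gaussWin differentiable_gaussWin integrable_gaussWin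
    integrable_fderiv_gaussWin planePt_eq_sum continuous_planePt differentiable_planeComp continuous_planeComp
    continuous_fderiv_planeComp_apply abs_planeComp_le abs_fderiv_planeComp_apply_le inner_curl_e3_eq)
open Summit.NavierStokesRegularity.NavierStokesRegularity.Theorems.LocalSineTubeDoorProfileAlignedWindowRigidityAncient
  (bdd_of_hasTypeITimeDecay analyticOnNhd_slice)
open Summit.NavierStokesRegularity.NavierStokesRegularity.Theorems.PoloidalWindowDoorPoloidalWindowRigidityClassSpaceTimeRates
  (exists_fderiv_rate_of_class')

/-! ### The windowed Stokes identity (exposed) -/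

section Stokes

variable {V : EuclideanSpace ℝ (Fin 3) → EuclideanSpace ℝ (Fin 3)}

/-- **Windowed Kelvin–Stokes identity on a horizontal plane.**  For a `C¹` field `V` on `ℝ³` with `‖V‖ ≤ B`, `‖DV‖ ≤ M`,
every `L > 0`, height `c` and centre `a`: the three integrands are integrable on `ℝ²` and
`∫ ⟪curl V(y,c), e₃⟫ g_{L,a}(y) dy = −∫ V₁(y,c) ∂₀g_{L,a}(y) dy + ∫ V₀(y,c) ∂₁g_{L,a}(y) dy`. -/
theorem integral_inner_curl_e3_mul_gaussWin_eq (hV : Differentiable ℝ V) (hVc : Continuous (fderiv ℝ V)) {B M : ℝ}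
    (hB : ∀ x, ‖V x‖ ≤ B) (hM : ∀ x, ‖fderiv ℝ V x‖ ≤ M) {L : ℝ} (hL : 0 < L) (c : ℝ)
    (a : EuclideanSpace ℝ (Fin 2)) :
    Integrable (fun y => ⟪curl V (planePt c y), e3⟫_ℝ * gaussWin L a y) ∧
      Integrable (fun y => V (planePt c y) 1 * fderiv ℝ (gaussWin L a) y (EuclideanSpace.single 0 1)) ∧
      Integrable (fun y => V (planePt c y) 0 * fderiv ℝ (gaussWin L a) y (EuclideanSpace.single 1 1)) ∧
      ∫ y, ⟪curl V (planePt c y), e3⟫_ℝ * gaussWin L a y =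
        -(∫ y, V (planePt c y) 1 * fderiv ℝ (gaussWin L a) y (EuclideanSpace.single 0 1)) +
          ∫ y, V (planePt c y) 0 * fderiv ℝ (gaussWin L a) y (EuclideanSpace.single 1 1) := by
  set f : Fin 3 → EuclideanSpace ℝ (Fin 2) → ℝ := fun i y => V (planePt c y) i with hf
  set g : EuclideanSpace ℝ (Fin 2) → ℝ := gaussWin L a with hg
  have hVcont : Continuous V := hV.continuous
  have hf_diff : ∀ i, Differentiable ℝ (f i) := fun i => differentiable_planeComp hV c i
  have hf_cont : ∀ i, Continuous (f i) := fun i => continuous_planeComp hVcont c i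
  have hf_bdd : ∀ i y, ‖f i y‖ ≤ B := fun i y =>
    (Real.norm_eq_abs _).le.trans ((abs_planeComp_le c i y).trans (hB _))
  have hDf_cont : ∀ i j, Continuous (fun y => fderiv ℝ (f i) y (EuclideanSpace.single j 1)) :=
    fun i j => continuous_fderiv_planeComp_apply hV hVc c i j
  have hDf_bdd : ∀ i j y, ‖fderiv ℝ (f i) y (EuclideanSpace.single j 1)‖ ≤ M := fun i j y =>
    (Real.norm_eq_abs _).le.trans ((abs_fderiv_planeComp_apply_le hV c i j y).trans (hM _))
  have hg_int : Integrable g := integrable_gaussWin hL a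
  have hg_diff : Differentiable ℝ g := differentiable_gaussWin L a
  have hDgj_int : ∀ j, Integrable (fun y => fderiv ℝ g y (EuclideanSpace.single j 1)) :=
    fun j => (integrable_fderiv_gaussWin hL a).apply_continuousLinearMap _
  have I1 : ∀ i j, Integrable (fun y => fderiv ℝ (f i) y (EuclideanSpace.single j 1) * g y) :=
    fun i j => hg_int.bdd_mul (hDf_cont i j).aestronglyMeasurable (ae_of_all _ (hDf_bdd i j))
  have I2 : ∀ i j, Integrable (fun y => f i y * fderiv ℝ g y (EuclideanSpace.single j 1)) :=
    fun i j => (hDgj_int j).bdd_mul (hf_cont i).aestronglyMeasurable (ae_of_all _ (hf_bdd i))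
  have I3 : ∀ i, Integrable (fun y => f i y * g y) :=
    fun i => hg_int.bdd_mul (hf_cont i).aestronglyMeasurable (ae_of_all _ (hf_bdd i))
  have IBP : ∀ i j, ∫ y, fderiv ℝ (f i) y (EuclideanSpace.single j 1) * g y =
      -∫ y, f i y * fderiv ℝ g y (EuclideanSpace.single j 1) := by
    intro i j
    have h := integral_mul_fderiv_eq_neg_fderiv_mul_of_integrable (μ := volume) (I1 i j) (I2 i j) (I3 i)
      (fun y _ => hf_diff i y) (fun y _ => hg_diff y)
    rw [h, neg_neg]
  have hident : (fun y => ⟪curl V (planePt c y), e3⟫_ℝ * gaussWin L a y) =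
      fun y => fderiv ℝ (f 1) y (EuclideanSpace.single 0 1) * g y -
        fderiv ℝ (f 0) y (EuclideanSpace.single 1 1) * g y := by
    funext y
    rw [inner_curl_e3_eq hV c y, sub_mul]
  refine ⟨?_, I2 1 0, I2 0 1, ?_⟩
  · rw [hident]
    exact (I1 1 0).sub (I1 0 1)
  · rw [hident, integral_sub (I1 1 0) (I1 0 1), IBP 1 0, IBP 0 1]
    ring

end Stokes

/-! ### Finite plane circulation under space–time decay -/

section Decay

variable {V : EuclideanSpace ℝ (Fin 3) → EuclideanSpace ℝ (Fin 3)}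

/-- The plane chart does not decrease norms: `‖y‖ ≤ ‖(y₀, y₁, c)‖`. -/
theorem norm_le_norm_planePt (c : ℝ) (y : EuclideanSpace ℝ (Fin 2)) : ‖y‖ ≤ ‖planePt c y‖ := by
  rw [EuclideanSpace.norm_eq, EuclideanSpace.norm_eq]
  apply Real.sqrt_le_sqrt
  simp only [Fin.sum_univ_two, Fin.sum_univ_three, Real.norm_eq_abs, sq_abs, planePt]
  simp
  nlinarith [sq_nonneg c]

/-- A partial derivative of the CENTRED window: `|∂_w g_{L,0}(y)| ≤ g_{L,0}(y) ‖y‖ ‖w‖ / (2L²)`. -/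
theorem abs_fderiv_gaussWin_zero_apply_le {L : ℝ} (hL : 0 < L) (y w : EuclideanSpace ℝ (Fin 2)) :
    |fderiv ℝ (gaussWin L 0) y w| ≤ gaussWin L 0 y * ‖y‖ * ‖w‖ / (2 * L ^ 2) := by
  rw [(hasFDerivAt_gaussWin L 0 y).fderiv, FunLike.coe_smul, Pi.smul_apply, innerSL_apply_apply, sub_zero, smul_eq_mul,
    abs_mul, abs_neg, abs_div, abs_of_pos (gaussWin_pos hL 0 y |>.trans_eq (gaussWin_eq_heatKernel L 0 y |>.trans
      (by rw [sub_zero]))), abs_of_pos (by positivity : (0 : ℝ) < 2 * L ^ 2)]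
  have h := abs_real_inner_le_norm y w
  rw [gaussWin_eq_heatKernel L 0 y, sub_zero]
  have hg : 0 ≤ heatKernel (L ^ 2) y := (heatKernel_pos (by positivity) y).le
  calc heatKernel (L ^ 2) y / (2 * L ^ 2) * |⟪y, w⟫_ℝ|
      ≤ heatKernel (L ^ 2) y / (2 * L ^ 2) * (‖y‖ * ‖w‖) := by gcongr
    _ = heatKernel (L ^ 2) y * ‖y‖ * ‖w‖ / (2 * L ^ 2) := by ring

/-- The centred window has unit mass: `∫ g_{L,0} = 1`. -/
theorem integral_gaussWin_zero {L : ℝ} (hL : 0 < L) : ∫ y, gaussWin L 0 y = 1 := by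
  rw [gaussWin_eq_heatKernel' L 0]
  simp only [sub_zero]
  exact integral_heatKernel_eq_one_holds (E := EuclideanSpace ℝ (Fin 2)) (by positivity)

/-- **Windowed circulation under spatial decay.**  For a `C¹` field `V` on `ℝ³` with `‖DV‖ ≤ M` and the decay
`‖V(x)‖ (‖x‖ + ρ) ≤ D` (`ρ > 0`), every `L > 0` and height `c`: `|∫ ⟪curl V(y,c), e₃⟫ g_{L,0}(y) dy| ≤ D/L²`. -/
theorem abs_integral_inner_curl_e3_mul_gaussWin_le_of_decay (hV : Differentiable ℝ V) (hVc : Continuous (fderiv ℝ V))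
    {M D ρ : ℝ} (hM : ∀ x, ‖fderiv ℝ V x‖ ≤ M) (hρ : 0 < ρ) (hD : ∀ x, ‖V x‖ * (‖x‖ + ρ) ≤ D) {L : ℝ} (hL : 0 < L)
    (c : ℝ) :
    Integrable (fun y => ⟪curl V (planePt c y), e3⟫_ℝ * gaussWin L 0 y) ∧
      |∫ y, ⟪curl V (planePt c y), e3⟫_ℝ * gaussWin L 0 y| ≤ D / L ^ 2 := by
  have hD0 : 0 ≤ D := le_trans (by positivity) (hD 0)
  -- `V` is bounded by `D/ρ`
  have hB : ∀ x, ‖V x‖ ≤ D / ρ := by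
    intro x
    rw [le_div_iff₀ hρ]
    calc ‖V x‖ * ρ ≤ ‖V x‖ * (‖x‖ + ρ) := by gcongr; exact le_add_of_nonneg_left (norm_nonneg _)
      _ ≤ D := hD x
  obtain ⟨hint, I10, I01, heq⟩ := integral_inner_curl_e3_mul_gaussWin_eq hV hVc hB hM hL c 0
  refine ⟨hint, ?_⟩
  -- pointwise: `|Vᵢ(y,c) ∂ⱼg_{L,0}(y)| ≤ D g_{L,0}(y)/(2L²)`
  have hpt : ∀ (i : Fin 3) (j : Fin 2) (y : EuclideanSpace ℝ (Fin 2)),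
      ‖V (planePt c y) i * fderiv ℝ (gaussWin L 0) y (EuclideanSpace.single j 1)‖ ≤ D / (2 * L ^ 2) * gaussWin L 0 y := by
    intro i j y
    rw [norm_mul, Real.norm_eq_abs, Real.norm_eq_abs]
    have h1 : |V (planePt c y) i| ≤ ‖V (planePt c y)‖ := abs_planeComp_le c i y
    have h2 := abs_fderiv_gaussWin_zero_apply_le hL y (EuclideanSpace.single j 1)
    rw [PiLp.norm_single, norm_one, mul_one] at h2
    have hg0 : 0 ≤ gaussWin L 0 y := (gaussWin_pos hL 0 y).le
    have h3 : ‖V (planePt c y)‖ * ‖y‖ ≤ D := by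
      calc ‖V (planePt c y)‖ * ‖y‖ ≤ ‖V (planePt c y)‖ * (‖planePt c y‖ + ρ) := by
            gcongr
            exact (norm_le_norm_planePt c y).trans (le_add_of_nonneg_right hρ.le)
        _ ≤ D := hD _
    calc |V (planePt c y) i| * |fderiv ℝ (gaussWin L 0) y (EuclideanSpace.single j 1)|
        ≤ ‖V (planePt c y)‖ * (gaussWin L 0 y * ‖y‖ / (2 * L ^ 2)) :=
          mul_le_mul h1 h2 (abs_nonneg _) (norm_nonneg _)
      _ = (‖V (planePt c y)‖ * ‖y‖) * gaussWin L 0 y / (2 * L ^ 2) := by ring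
      _ ≤ D * gaussWin L 0 y / (2 * L ^ 2) := by gcongr
      _ = D / (2 * L ^ 2) * gaussWin L 0 y := by ring
  have hgi : Integrable (fun y => D / (2 * L ^ 2) * gaussWin L 0 y) := (integrable_gaussWin hL 0).const_mul _
  have hterm : ∀ (i : Fin 3) (j : Fin 2),
      |∫ y, V (planePt c y) i * fderiv ℝ (gaussWin L 0) y (EuclideanSpace.single j 1)| ≤ D / (2 * L ^ 2) := by
    intro i j
    have h := norm_integral_le_of_norm_le hgi (ae_of_all _ (hpt i j))
    rw [Real.norm_eq_abs, integral_const_mul, integral_gaussWin_zero hL, mul_one] at h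
    exact h
  rw [heq]
  calc |-(∫ y, V (planePt c y) 1 * fderiv ℝ (gaussWin L 0) y (EuclideanSpace.single 0 1)) +
          ∫ y, V (planePt c y) 0 * fderiv ℝ (gaussWin L 0) y (EuclideanSpace.single 1 1)|
      ≤ |-(∫ y, V (planePt c y) 1 * fderiv ℝ (gaussWin L 0) y (EuclideanSpace.single 0 1))| +
          |∫ y, V (planePt c y) 0 * fderiv ℝ (gaussWin L 0) y (EuclideanSpace.single 1 1)| := abs_add_le _ _
    _ ≤ D / (2 * L ^ 2) + D / (2 * L ^ 2) := by
        rw [abs_neg]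
        exact add_le_add (hterm 1 0) (hterm 0 1)
    _ = D / L ^ 2 := by ring

/-- **FINITE PLANE CIRCULATION OF THE SIGN CLASS UNDER SPATIAL DECAY.**  For a `C¹` field `V` on `ℝ³` with bounded gradient,
the decay `‖V(x)‖ (‖x‖ + ρ) ≤ D` (`ρ > 0`) and the sign `⟪curl V, e₃⟫ ≥ 0`: on every horizontal plane the total `e₃`-flux is
finite, `∫⁻_{ℝ²} ⟪curl V(y,c), e₃⟫ dy ≤ 4πD` (monotone convergence along the centred windows `e^{−‖y‖²/(4n²)} = 4πn² g_{n,0} ↑ 1`). -/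
theorem planeFlux_le_of_decay (hV : Differentiable ℝ V) (hVc : Continuous (fderiv ℝ V)) {M D ρ : ℝ}
    (hM : ∀ x, ‖fderiv ℝ V x‖ ≤ M) (hρ : 0 < ρ) (hD : ∀ x, ‖V x‖ * (‖x‖ + ρ) ≤ D)
    (hnn : ∀ x, 0 ≤ ⟪curl V x, e3⟫_ℝ) (c : ℝ) :
    ∫⁻ y, ENNReal.ofReal ⟪curl V (planePt c y), e3⟫_ℝ ≤ ENNReal.ofReal (4 * Real.pi * D) := by
  have hD0 : 0 ≤ D := le_trans (by positivity) (hD 0)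
  -- continuity of the plane vorticity component (through the in-plane curl formula)
  have hω_cont : Continuous (fun y : EuclideanSpace ℝ (Fin 2) => ⟪curl V (planePt c y), e3⟫_ℝ) := by
    have h : (fun y : EuclideanSpace ℝ (Fin 2) => ⟪curl V (planePt c y), e3⟫_ℝ) =
        fun y => fderiv ℝ (fun y => V (planePt c y) 1) y (EuclideanSpace.single 0 1) -
          fderiv ℝ (fun y => V (planePt c y) 0) y (EuclideanSpace.single 1 1) :=
      funext fun y => inner_curl_e3_eq hV c y
    rw [h]
    exact (continuous_fderiv_planeComp_apply hV hVc c 1 0).sub (continuous_fderiv_planeComp_apply hV hVc c 0 1)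
  -- the approximants `ω₃ e^{−‖y‖²/(4(n+1)²)}` increase to `ω₃`
  have hφ_meas : ∀ n : ℕ, AEMeasurable (fun y : EuclideanSpace ℝ (Fin 2) =>
      ENNReal.ofReal (⟪curl V (planePt c y), e3⟫_ℝ * Real.exp (-‖y‖ ^ 2 / (4 * ((n : ℝ) + 1) ^ 2)))) volume := by
    intro n
    refine (Measurable.ennreal_ofReal ?_).aemeasurable
    exact (hω_cont.mul (Real.continuous_exp.comp (((continuous_norm.pow 2).neg).div_const _))).measurable
  have hφ_mono : ∀ y : EuclideanSpace ℝ (Fin 2), Monotone fun n : ℕ =>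
      ENNReal.ofReal (⟪curl V (planePt c y), e3⟫_ℝ * Real.exp (-‖y‖ ^ 2 / (4 * ((n : ℝ) + 1) ^ 2))) := by
    intro y m n hmn
    apply ENNReal.ofReal_le_ofReal
    apply mul_le_mul_of_nonneg_left _ (hnn _)
    apply Real.exp_le_exp.2
    rw [neg_div, neg_div, neg_le_neg_iff]
    have hmn' : (m : ℝ) + 1 ≤ (n : ℝ) + 1 := by
      have : (m : ℝ) ≤ n := by exact_mod_cast hmn
      linarith
    exact div_le_div_of_nonneg_left (sq_nonneg _) (by positivity) (by gcongr)
  have hφ_tend : ∀ y : EuclideanSpace ℝ (Fin 2), Tendsto (fun n : ℕ =>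
      ENNReal.ofReal (⟪curl V (planePt c y), e3⟫_ℝ * Real.exp (-‖y‖ ^ 2 / (4 * ((n : ℝ) + 1) ^ 2)))) atTop
      (𝓝 (ENNReal.ofReal ⟪curl V (planePt c y), e3⟫_ℝ)) := by
    intro y
    have hden : Tendsto (fun n : ℕ => 4 * ((n : ℝ) + 1) ^ 2) atTop atTop := by
      have h1 : Tendsto (fun n : ℕ => (n : ℝ) + 1) atTop atTop :=
        tendsto_atTop_add_const_right _ _ tendsto_natCast_atTop_atTop
      exact ((tendsto_pow_atTop two_ne_zero).comp h1).const_mul_atTop (by norm_num)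
    have h1 : Tendsto (fun n : ℕ => -‖y‖ ^ 2 / (4 * ((n : ℝ) + 1) ^ 2)) atTop (𝓝 0) :=
      tendsto_const_nhds.div_atTop hden
    have h2 : Tendsto (fun n : ℕ => Real.exp (-‖y‖ ^ 2 / (4 * ((n : ℝ) + 1) ^ 2))) atTop (𝓝 1) := by
      have h := (Real.continuous_exp.tendsto 0).comp h1
      rwa [Real.exp_zero] at h
    have h3 : Tendsto (fun n : ℕ => ⟪curl V (planePt c y), e3⟫_ℝ * Real.exp (-‖y‖ ^ 2 / (4 * ((n : ℝ) + 1) ^ 2)))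
        atTop (𝓝 ⟪curl V (planePt c y), e3⟫_ℝ) := by
      simpa using h2.const_mul ⟪curl V (planePt c y), e3⟫_ℝ
    exact (ENNReal.continuous_ofReal.tendsto _).comp h3
  have hlim := lintegral_tendsto_of_tendsto_of_monotone hφ_meas (ae_of_all _ hφ_mono) (ae_of_all _ hφ_tend)
  refine le_of_tendsto' hlim fun n => ?_
  -- the bound for each approximant, with `L = n + 1`: `e^{−‖y‖²/(4L²)} = 4πL² g_{L,0}(y)`
  have hL : (0 : ℝ) < (n : ℝ) + 1 := by positivity
  obtain ⟨hint, hle⟩ := abs_integral_inner_curl_e3_mul_gaussWin_le_of_decay hV hVc hM hρ hD hL c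
  have hfac : ∀ y : EuclideanSpace ℝ (Fin 2), ⟪curl V (planePt c y), e3⟫_ℝ * Real.exp (-‖y‖ ^ 2 / (4 * ((n : ℝ) + 1) ^ 2)) =
      (4 * Real.pi * ((n : ℝ) + 1) ^ 2) * (⟪curl V (planePt c y), e3⟫_ℝ * gaussWin ((n : ℝ) + 1) 0 y) := by
    intro y
    rw [gaussWin, sub_zero]
    field_simp
  have hnn' : 0 ≤ᵐ[volume] fun y => ⟪curl V (planePt c y), e3⟫_ℝ * gaussWin ((n : ℝ) + 1) 0 y :=
    ae_of_all _ fun y => mul_nonneg (hnn _) (gaussWin_pos hL 0 y).le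
  have hc0 : (0 : ℝ) ≤ 4 * Real.pi * ((n : ℝ) + 1) ^ 2 := by positivity
  calc ∫⁻ y, ENNReal.ofReal (⟪curl V (planePt c y), e3⟫_ℝ * Real.exp (-‖y‖ ^ 2 / (4 * ((n : ℝ) + 1) ^ 2)))
      = ∫⁻ y, ENNReal.ofReal (4 * Real.pi * ((n : ℝ) + 1) ^ 2) *
          ENNReal.ofReal (⟪curl V (planePt c y), e3⟫_ℝ * gaussWin ((n : ℝ) + 1) 0 y) := by
        refine lintegral_congr fun y => ?_
        rw [hfac y, ENNReal.ofReal_mul hc0]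
    _ = ENNReal.ofReal (4 * Real.pi * ((n : ℝ) + 1) ^ 2) *
          ∫⁻ y, ENNReal.ofReal (⟪curl V (planePt c y), e3⟫_ℝ * gaussWin ((n : ℝ) + 1) 0 y) :=
        lintegral_const_mul' _ _ ENNReal.ofReal_ne_top
    _ = ENNReal.ofReal (4 * Real.pi * ((n : ℝ) + 1) ^ 2) *
          ENNReal.ofReal (∫ y, ⟪curl V (planePt c y), e3⟫_ℝ * gaussWin ((n : ℝ) + 1) 0 y) := by
        rw [ofReal_integral_eq_lintegral_ofReal hint hnn']
    _ ≤ ENNReal.ofReal (4 * Real.pi * ((n : ℝ) + 1) ^ 2) * ENNReal.ofReal (D / ((n : ℝ) + 1) ^ 2) := by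
        gcongr
        exact (le_abs_self _).trans hle
    _ = ENNReal.ofReal (4 * Real.pi * D) := by
        rw [← ENNReal.ofReal_mul hc0]
        congr 1
        field_simp

end Decay

/-! ### The class form -/

/-- **A closed-hemisphere profile of the route's Type-I class with SPACE–TIME Type-I decay carries finite, uniformly
bounded plane circulation**: `∫⁻_{ℝ²} ⟪curl v(s)(y,c), e₃⟫ dy ≤ 4πD` for every `s < 0` and height `c`, where `D` is the
space–time decay constant (`‖v(t,x)‖ ≤ D/(‖x‖ + √(−t))`).  The slices are smooth with bounded gradient
(`analyticOnNhd_slice`, `exists_fderiv_rate_of_class'`), so `planeFlux_le_of_decay` applies with `ρ = √(−s)`. -/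
theorem planeFlux_le_of_class_of_hasTypeIDecay :
    ∀ (C D : ℝ) (v : ℝ → EuclideanSpace ℝ (Fin 3) → EuclideanSpace ℝ (Fin 3)),
    Literature.Analysis.FluidPDE.HasTypeITimeDecay C v → Literature.Analysis.FluidPDE.HasTypeIDecay D v →
    ContinuousOn (Function.uncurry v) (Set.Iio (0 : ℝ) ×ˢ Set.univ) →
    (∀ s t : ℝ, s < t → t < 0 → ∀ x, v t x =
      Literature.Analysis.UnboundedOperators.heatExtension (v s) (t - s) x -
        Literature.Analysis.FluidPDE.oseenDuhamel 1 s v v t x) →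
    (∀ s < 0, ∀ y, 0 ≤ ⟪Literature.Analysis.FluidPDE.curl (v s) y, e3⟫_ℝ) →
    ∀ s < 0, ∀ c : ℝ,
      ∫⁻ y, ENNReal.ofReal ⟪Literature.Analysis.FluidPDE.curl (v s) (planePt c y), e3⟫_ℝ ≤ ENNReal.ofReal (4 * Real.pi * D) := by
  intro C D v hrate hdec hcont hmild hnn s hs c
  have hA : AnalyticOnNhd ℝ (v s) univ := analyticOnNhd_slice hcont (bdd_of_hasTypeITimeDecay hrate) hmild hs
  have hVd : Differentiable ℝ (v s) := fun x => (hA x (mem_univ x)).differentiableAt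
  have hVc : Continuous (fderiv ℝ (v s)) := continuousOn_univ.1 hA.fderiv.continuousOn
  obtain ⟨K₁, -, hK₁⟩ := exists_fderiv_rate_of_class' hrate hcont hmild
  have hρ : 0 < Real.sqrt (-s) := Real.sqrt_pos.2 (neg_pos.2 hs)
  have hD : ∀ x, ‖v s x‖ * (‖x‖ + Real.sqrt (-s)) ≤ D := by
    intro x
    have h := hdec s hs x
    have hpos : 0 < ‖x‖ + Real.sqrt (-s) := by positivity
    rwa [le_div_iff₀ hpos] at h
  exact planeFlux_le_of_decay hVd hVc (hK₁ s hs) hρ hD (hnn s hs) c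

end Summit.NavierStokesRegularity.NavierStokesRegularity.Theorems.HalfSpaceWindowDoorCirculationCarryingRigidityPlaneFlux

end
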